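import Summits.QuantumFields.YangMills.Theorems.BalabanUVNodesN07NormalisationOfRecord
import Summits.QuantumFields.YangMills.Theorems.UnitScaleTiltProp8ChartLocality
import HarnessLib

/-!
# N07 [B11] (= [15] = [Balaban1985Variational]) Sect. F — THE NORMALISATION OF RECORD AT BOTH ENDS OF **EVERY** CONSTRAINT BOND: LOCATED-CROSSING-ENDS resolved by the (2.2)
# collar ([4] p. 224) and one step of [3] (80) — print's «ū_j = 1 on Λ′_j» on the cells gives `R̄ʲg = 1` at the two ends of each bond of `BondIdx D″`, hence (154)₁ on the chart's index set

Cell `pub-ymgap`, seat `pub-ymgap-dag-n07-e` g23 (FAN-OUT §N07 row s3; LANE OWNER of the K0 road), MODULE 61, INTENT-61 (cell bus 2026-08-28T18:14Z).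
`--kind proof --supports stmt-QuantumFields-20541 --as helper` (K0⁷; dag-lead KEY MAP v2); count-neutral; def-free.
[15] = [Balaban1985Variational]; [3] = [Balaban1985Averaging]; [4] = [Balaban1984PropagatorsII]; [6] = [Balaban1985RegularSpaces].

WHY.  MODULE 60 (`…N07NormalisationOfRecord`, p655779) declared the normalisation of record `NrmOfRecord` = «`R̄^{j′}g = 1` on the cell SITES `Λ′_{j′}(D″)`» and derived (154)₁
(`𝒜_{j′}(U^u)(c) = M^{j′}(U″)(c)`) at bonds whose TWO ends are cells.  The chart's datum `B : BondIdx D″ → MatA N` (MODULE 59's HCHART-MEET-NORM) ranges over the tree's constraint bonds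
`LamBond j b :↔ (b₋ ∈ Ω_j ∨ b₊ ∈ Ω_j) ∧ ¬Deep b₋ ∧ ¬Deep b₊` ([4] (2.3) read INCLUSIVELY: «Ω also the set of bonds ⋃_{x∈Ω} st(x)»), so a bond may have ONE end `y′` outside `Ω″_j` — where
print's «ū_j = 1 on Λ′_j» says nothing AT LEVEL `j`.  It says enough one level down: by the (2.2) COLLAR (route UnitScaleTilt `Prop8Chart.collar_of_adm22`: under `Adm22 D R M` with
`2L ≤ R·M + 1` both blocks of every constraint bond of level `i+1` are filled by `Ω_i^{(i)}`) every level-`i` sub-site `z` of `y′` lies in `Ω″_i`, and `B(z) = y′ ∉ Ω″_{i+1}` makes it a cell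
site of `Λ′_i`; so `R̄^i g ≡ 1` on `B(y′)` and ONE STEP of [3] (80), `R̄^{i+1}g(y′) = R̄^i g(y′↓)·𝓔_{y′}{R̄^i g(y′↓)⁻¹·R̄^i g(x)}_{x∈B(y′)} = 1·𝓔{1} = 1`, normalises the outer end too.  Level-`0`
bonds have both ends in `Λ′₀` because `Ω″₀ = T`.

WHAT IS PROVED (sorry-free; no definition; axioms standard; [folklore] group bookkeeping + by-name composition — NOTHING of [15]∕[3]∕[4] analysis).
§1 (generic torus family `P`, gauge group `G`, small-loop average `ℰ` with `ℰ{1} = 1`) `gaugeAvgF_eq_one_of_forall_block` · `gaugeAvgIter_succ_eq_one_of_forall_block` ([3] (78)–(80)).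
§2 (any `Domains D` under `Adm22 D R M`, `2L ≤ R·M + 1`) `lamSite_ends_of_lamBond_zero` · ★ `lamSite_or_forall_block_of_lamBond_end` (an end of a constraint bond is a cell site of its level, or
ALL its sub-sites are cell sites one level down).  §3 `gaugeAvgIter_lamBond_end_eq_one` · ★★ `gaugeAvgIter_bondIdx_ends_eq_one` — normalisation on every cell site of every level `≤ D.k` ⇒ normalisation at
BOTH ends of EVERY `c : BondIdx D`.  §4 AT THE RECORD ★★★ `NrmOfRecord.exists_rep_bondIdx` — under `NrmOfRecord F N Mc ρ …` and `Adm22 D″ R M` (`2L ≤ R·M + 1`; MODULE 59's knit holds `Adm22 D″ R (L·M_h)` by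
dag-n07-w4's FILE D0 `adm22_meetCube_trunc_seqOfRecord`): `∃ w` (residual radial axialiser) with `𝒜_{c.1.1}(U^u)(c.1.2) = M^{c.1.1}((U^w)^{h̄})(c.1.2)` for EVERY `c : BondIdx D″` — the
chart's index set exactly (MODULE 60 `shearedAvgIter_landau_eq_iter_rep` by name).

HONEST SCOPE.  Count-neutral bookkeeping; `NrmOfRecord`, HS3NORM, HCHART-MEET-NORM, HBUDGET-NORM remain DISPLAYED hypotheses of MODULE 59's knit, discharged by nobody here; `Adm22` is a
hypothesis of §2–§4; stub 1-G‴ ∕ K0⁷ ∕ K1⁹ NOT closed; N07 ∕ N05 NOT discharged; counts unmoved (typed 28∕28 · discharged 5∕27); one finite 𝕋⁴ programme at fixed ε — the route closes the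
conditional finite-𝕋⁴ rung `BalabanLadder.UV` ONLY; the YM mass gap (Clay) is NOT proved by any of this; nothing continuum ∕ ℝ⁴ ∕ OS.  No `sorry`, no `def`, no `instance`, no `notation`.

References: [15] (150)–(154) pp. 301–302; [3] (78)–(81) p. 30, (88) p. 31; [4] (2.1)–(2.3) p. 224; [6] (1.3)–(1.4) p. 77, (1.29) p. 81.
-/

set_option autoImplicit false

noncomputable section

namespace Summit.QuantumFields.YangMills.BalabanUVNodes.N07NormalisationCrossingEnds

open Literature.MathematicalPhysics.QuantumFieldTheory.Balaban1983to89
open Literature.MathematicalPhysics.QuantumFieldTheory.Balaban1983to89.Node00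
open T4Continuum (T4Family)
open T4AxialGaugeSmallField (axialGauge)
open B12GaugeOrbits021 (IsResidual)
open B15Eq177GaugeInvariance (blockLift)
open B14DomainGeom (Pt)
open B8Eq131Cubes (sqLo sqHi)
open B6SectADomainsV1 (Domains)
open B6SectAOperatorsV1 (BondIdx)
open GaugeField (gaugeAct)
open ExpMeanLog (expMeanLogSU)
open Summit.QuantumFields.Balaban3D.Carriers (radialContourData)
open Summit.QuantumFields.YangMills.Theorems.FlatCubeOpsText (Adm22)
open Summit.QuantumFields.YangMills.Theorems.Prop8Chart (collar_of_adm22)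
open Summit.QuantumFields.YangMills.BalabanUVNodes.N07NormalisationOfRecord (NrmOfRecord shearedAvgIter_landau_eq_iter_rep)

/-! ## §1  One step of [3] (80): a block on which `R̄ⁱg ≡ 1` averages to `R̄^{i+1}g = 1` -/

section OneStep

variable {P : Params} {G : Type*} [GaugeGroup G] (ℰ : LoopAverage G)

/-- **[3] (78) at a block of ones**: if the gauge function `v` of `T^{(i)}` is `1` on the whole block `B(y)`, its base-point-factored one-step average is `1` at `y`:
`(R̄v)(y) = v(y↓)·𝓔_y{v(y↓)⁻¹ v(x)} = 1·𝓔_y{1} = 1` (`ℰ{1,…,1} = 1`). [cite: Balaban1985Averaging, (78) p.30] -/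
theorem gaugeAvgF_eq_one_of_forall_block (hE : ∀ n : ℕ, ℰ.E (fun _ : Fin (n + 1) => (1 : G)) = 1) {i : ℕ} (hi : i + 1 ≤ P.m + P.K)
    {v : GaugeTransf P i G} {y : Site P (i + 1)} (hv : ∀ x : Site P i, blockOf x = y → v x = 1) :
    gaugeAvgF (loopAvgBlockOp ℰ i) v y = 1 := by
  have hy : v (emb y) = 1 := hv (emb y) (Site.blockOf_emb hi y)
  unfold gaugeAvgF
  rw [hy, one_mul]
  exact loopAvgBlockOp_congr_one ℰ hE i y _ fun x hx => by rw [inv_one, one_mul, hv x hx]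

/-- **[3] (80), one step up**: if `R̄ⁱg = 1` on the whole block `B(y)` of a site `y` of `T^{(i+1)}`, then `R̄^{i+1}g(y) = 1`. [cite: Balaban1985Averaging, (79)–(80) p.30] -/
theorem gaugeAvgIter_succ_eq_one_of_forall_block (hE : ∀ n : ℕ, ℰ.E (fun _ : Fin (n + 1) => (1 : G)) = 1) {i : ℕ} (hi : i + 1 ≤ P.m + P.K)
    (g : GaugeTransf P 0 G) {y : Site P (i + 1)} (hg : ∀ x : Site P i, blockOf x = y → gaugeAvgIter (loopAvgBlockOp ℰ) g i x = 1) :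
    gaugeAvgIter (loopAvgBlockOp ℰ) g (i + 1) y = 1 := by
  rw [gaugeAvgIter_succ]
  exact gaugeAvgF_eq_one_of_forall_block ℰ hE hi hg

end OneStep

/-! ## §2  The ends of a constraint bond: a cell site, or a block of cell sites one level down ((2.2) collar) -/

section Ends

variable {P : Params} (D : Domains P)

/-- At level `0` both ends of every constraint bond are cell sites of `Λ₀` (`Ω₀ = T`). [cite: Balaban1984PropagatorsII, (2.1) p.224, (2.3) p.224] -/
theorem lamSite_ends_of_lamBond_zero {b : PBond P 0} (h : D.LamBond 0 b) : D.LamSite 0 b.src ∧ D.LamSite 0 b.tgt := by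
  obtain ⟨-, hs, ht⟩ := h
  have h0 : ∀ y : Site P 0, y ∈ D.Om 0 := fun y => by rw [D.Om_zero]; exact Finset.mem_univ y
  exact ⟨⟨h0 _, hs⟩, ⟨h0 _, ht⟩⟩

/-- ★ **AN END OF A CONSTRAINT BOND OF LEVEL `i+1` IS A CELL SITE OF `Λ_{i+1}`, OR ALL ITS SUB-SITES ARE CELL SITES OF `Λ_i`** — under the (2.2)-admissibility `Adm22 D R M` with
`2L ≤ R·M + 1`: an end inside `Ω_{i+1}^{(i+1)}` is a cell site (no end of a constraint bond is deep); an end `y′` outside has every `z ∈ B(y′)` in `Ω_i^{(i)}` by the collar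
(`Prop8Chart.collar_of_adm22`) and not deep (`B(z) = y′ ∉ Ω_{i+1}`). [cite: Balaban1984PropagatorsII, (2.1)–(2.3) p.224; Balaban1985RegularSpaces, (1.3)–(1.4) p.77] -/
theorem lamSite_or_forall_block_of_lamBond_end {R M : ℕ} (hAdm : Adm22 D R M) (hRM : 2 * P.L ≤ R * M + 1) {i : ℕ} {e : PBond P (i + 1)}
    (he : D.LamBond (i + 1) e) {y : Site P (i + 1)} (hy : y = e.src ∨ y = e.tgt) :
    D.LamSite (i + 1) y ∨ ∀ z : Site P i, blockOf z = y → D.LamSite i z := by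
  have hnd : ¬ D.Deep (i + 1) y := by
    rcases hy with rfl | rfl
    · exact he.2.1
    · exact he.2.2
  by_cases hmem : y ∈ D.Om (i + 1)
  · exact Or.inl ⟨hmem, hnd⟩
  · refine Or.inr fun z hz => ⟨?_, ?_⟩
    · exact collar_of_adm22 D hAdm hRM i e he z (by rcases hy with rfl | rfl <;> simp [hz])
    · show blockOf z ∉ D.Om (i + 1)
      rw [hz]; exact hmem

end Ends

/-! ## §3  Normalisation on every cell site ⇒ normalisation at both ends of every constraint bond -/

section AllBonds

variable {P : Params} {G : Type*} [GaugeGroup G] (ℰ : LoopAverage G) (D : Domains P)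

/-- **CELLS ⇒ BOND ENDS, by the level** (the induction-free case split behind `gaugeAvgIter_bondIdx_ends_eq_one`): level `0` by `Ω₀ = T`, level `i+1` by §2 + one step of [3] (80).
[cite: Balaban1985Averaging, (78)–(81) p.30; Balaban1984PropagatorsII, (2.1)–(2.3) p.224] -/
theorem gaugeAvgIter_lamBond_end_eq_one (hE : ∀ n : ℕ, ℰ.E (fun _ : Fin (n + 1) => (1 : G)) = 1) {R M : ℕ} (hAdm : Adm22 D R M) (hRM : 2 * P.L ≤ R * M + 1)
    (g : GaugeTransf P 0 G) (hcells : ∀ j' : ℕ, j' ≤ D.k → ∀ y : Site P j', D.LamSite j' y → gaugeAvgIter (loopAvgBlockOp ℰ) g j' y = 1) :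
    ∀ (n : ℕ) (e : PBond P n), D.LamBond n e → ∀ y : Site P n, (y = e.src ∨ y = e.tgt) → gaugeAvgIter (loopAvgBlockOp ℰ) g n y = 1
  | 0, e, he, y, hy => by
      refine hcells 0 (Nat.zero_le _) y ?_
      rcases hy with rfl | rfl
      · exact (lamSite_ends_of_lamBond_zero D he).1
      · exact (lamSite_ends_of_lamBond_zero D he).2
  | i + 1, e, he, y, hy => by
      have hk : i + 1 ≤ D.k := D.le_of_lamBond he
      have hi1 : i + 1 ≤ P.m + P.K := hk.trans D.hk
      rcases lamSite_or_forall_block_of_lamBond_end D hAdm hRM he hy with hcell | hblock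
      · exact hcells _ hk y hcell
      · exact gaugeAvgIter_succ_eq_one_of_forall_block ℰ hE hi1 g fun z hz => hcells i (by omega) z (hblock z hz)

/-- ★★ **CELLS ⇒ BOND ENDS**: if `R̄^{j′}g = 1` at every cell site of `Λ_{j′}`, `j′ ≤ D.k`, then `R̄^{j(c)}g = 1` at BOTH ends of EVERY constraint bond `c : BondIdx D` (`Adm22 D R M`,
`2L ≤ R·M + 1`, `ℰ{1} = 1`).
[cite: Balaban1985Averaging, (78)–(81) p.30; Balaban1984PropagatorsII, (2.1)–(2.3) p.224; Balaban1985Variational, (152) p.301 («ū_j = 1 on Λ′_j»)] -/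
theorem gaugeAvgIter_bondIdx_ends_eq_one (hE : ∀ n : ℕ, ℰ.E (fun _ : Fin (n + 1) => (1 : G)) = 1) {R M : ℕ} (hAdm : Adm22 D R M) (hRM : 2 * P.L ≤ R * M + 1)
    (g : GaugeTransf P 0 G) (hcells : ∀ j' : ℕ, j' ≤ D.k → ∀ y : Site P j', D.LamSite j' y → gaugeAvgIter (loopAvgBlockOp ℰ) g j' y = 1) (c : BondIdx D) :
    gaugeAvgIter (loopAvgBlockOp ℰ) g (c.1.1 : ℕ) c.1.2.src = 1 ∧ gaugeAvgIter (loopAvgBlockOp ℰ) g (c.1.1 : ℕ) c.1.2.tgt = 1 :=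
  ⟨gaugeAvgIter_lamBond_end_eq_one ℰ D hE hAdm hRM g hcells _ c.1.2 c.2 _ (Or.inl rfl),
    gaugeAvgIter_lamBond_end_eq_one ℰ D hE hAdm hRM g hcells _ c.1.2 c.2 _ (Or.inr rfl)⟩

end AllBonds

/-! ## §4  At the record: (154)₁ on EVERY constraint bond of print's local family `D″` -/

section Record

variable {F : T4Family} {N : ℕ} [NeZero N]

/-- ★★★ **(154)₁ ON THE CHART's WHOLE INDEX SET**: if S3's gauge `u` carries the normalisation of record at the datum `(j, idx)` and print's local family
`D″ = domainsMeet (cubeDomains … j ·) (domainsOfSeq s.Ω j ·)` is (2.2)-admissible (`Adm22 D″ R M` with `2L ≤ R·M + 1` — MODULE 59's knit has `Adm22 D″ R (L·M_h)` by FILE D0), then for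
the witness `w` (residual radial axialiser) and `h` the coarse axial gauge of the datum's top box, `𝒜_{j(c)}(U^u)(c) = M^{j(c)}((U^w)^{h̄})(c)` for EVERY `c : BondIdx D″` — no condition on
the ends left (§3 supplies `R̄g = 1` at both ends, MODULE 60 `shearedAvgIter_landau_eq_iter_rep` the identity).
[cite: Balaban1985Variational, (150)–(154) pp.301–302; Balaban1985Averaging, (80) p.30, (88) p.31; Balaban1984PropagatorsII, (2.1)–(2.3) p.224] -/
theorem NrmOfRecord.exists_rep_bondIdx {Mc ρ : ℕ} {ν : Stage7Numerics} {M : ℕ} {g : ℕ → ℝ} {K k : ℕ} {s : SeqOfRecord F ν M g K k}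
    {U : GaugeField (F.P K) 0 (SU N)} {j : ℕ} {idx : Pt (F.P K).d} {u : GaugeTransf (F.P K) 0 (SU N)} {A : PBond (F.P K) 0 → MatA N}
    (hN : NrmOfRecord F N Mc ρ ν M g K k s U j idx u A) (hk : j ≤ (F.P K).m + (F.P K).K) {R Mb : ℕ}
    (hAdm : Adm22 (domainsMeet (cubeDomains (F.P K) (cornerP (F.P K) Mc ρ idx) (sideP (F.P K) Mc ρ) ρ j hk) (domainsOfSeq s.Ω j hk)) R Mb)
    (hRM : 2 * (F.P K).L ≤ R * Mb + 1) :
    ∃ w : GaugeTransf (F.P K) 0 (SU N), IsResidual j w ∧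
      (∀ i < j, AxialGauge (radialContourData (F.P K) i (SU N)) (Averaging.iter (avOfRecord F N K) i (gaugeAct w U))) ∧
      ∀ c : BondIdx (domainsMeet (cubeDomains (F.P K) (cornerP (F.P K) Mc ρ idx) (sideP (F.P K) Mc ρ) ρ j hk) (domainsOfSeq s.Ω j hk)),
        shearedAvgIter (avOfRecord F N K) (fun i => radialContourData (F.P K) i (SU N)) (loopAvgBlockOp expMeanLogSU) (gaugeAct u U) (c.1.1 : ℕ) c.1.2 =
          Averaging.iter (avOfRecord F N K) (c.1.1 : ℕ)
            (gaugeAct (blockLift j (axialGauge (Averaging.iter (avOfRecord F N K) j (gaugeAct w U))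
              (sqLo (F.P K).L (cornerP (F.P K) Mc ρ idx) ρ j j - 1) (sqHi (F.P K).L (cornerP (F.P K) Mc ρ idx) (sideP (F.P K) Mc ρ) ρ j j + 1)))
              (gaugeAct w U)) c.1.2 := by
  obtain ⟨w, hres, hax, hnorm⟩ := hN
  set D'' := domainsMeet (cubeDomains (F.P K) (cornerP (F.P K) Mc ρ idx) (sideP (F.P K) Mc ρ) ρ j hk) (domainsOfSeq s.Ω j hk) with hD''
  have hDk : D''.k ≤ j := by
    show min j j ≤ j
    exact min_le_left _ _
  refine ⟨w, hres, hax, fun c => ?_⟩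
  have hends := gaugeAvgIter_bondIdx_ends_eq_one expMeanLogSU D'' (expMeanLogSU_E_one' N) hAdm hRM _
    (fun j' hj' y hy => hnorm hk j' (hj'.trans hDk) y hy) c
  have hcj : (c.1.1 : ℕ) ≤ j := (D''.le_of_lamBond c.2).trans hDk
  exact shearedAvgIter_landau_eq_iter_rep F N K hk hax _ u hcj hends.1 hends.2

end Record

end Summit.QuantumFields.YangMills.BalabanUVNodes.N07NormalisationCrossingEnds

end
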